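import Summits.HubbardSuperconductivity.HubbardSuperconductivity.Theorems.ChiralWindowCwSsbToEvenTorusLROBlockSlope
import Summits.HubbardSuperconductivity.HubbardSuperconductivity.Theorems.ChiralWindowCwSsbToEvenTorusLROSourceRemoval
import Literature.MathematicalPhysics.QuantumLattice.DWaveOrderParameterProofs
import HarnessLib

/-!
# Crux `CwSsbToEvenTorusLRO` (stmt-HubbardSuperconductivity-10439, route `ChiralWindow`), line
`griffiths-block-slope` — stub `stub_attractiveChordFloor` (S6, the attractive chord floor)

With `K_μ = hubbardTorusWith 2 L 1 U μ` (the SOURCE-FREE grand-canonical Hubbard torus), the sourced torus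
`T_h = dWaveSourceTorus L U μ h = K_μ - h(P + Pᴴ)`, `P = pairField dWaveFormFactor L`, the Kac block
operator `W_R = R⁻⁴ Σ_a B_aᴴ B_a`, `B_a = Σ_{u ∈ [0,R)²} P_{a+u}`, `E₀ = Matrix.groundEnergy` and
`m = dWaveOrderParameter U μ`, the stub asserts, for all `U, μ`, every `R ≥ 1`, every `t ≥ 0` and every
`ε > 0`, eventually in the side `L + 1`,

`t (m² - ε) (L+1)² ≤ E₀(K_μ) - E₀(K_μ - t W_R)`:

Koma–Tasaki `d`-wave order forces the ATTRACTIVE block slope of the source-free grand-canonical ground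
energy to be at least `m²`.

Proof (finite `L`, from two landed stubs of the line and the order-parameter staircase):

* S1 `stub_blockSlope` at `κ = 0`: `E₀(T_h - tW_R) - E₀(T_h) ≤ -t (Re ω_{T_h}(P))² / (L+1)²
  = -t D² (L+1)²`, `D = dWaveSourceDensity (L+1) U μ h`;
* S4 `stub_sourceRemoval` twice (couplings `-t` and `0`): `|E₀(T_h - tW_R) - E₀(K_μ - tW_R)| ≤ 12 h (L+1)²`,
  `|E₀(T_h) - E₀(K_μ)| ≤ 12 h (L+1)²`, with the source `h = tε/48` (total cost `tε(L+1)²/2`);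
* the staircase lever `dWaveOrderParameter_le_liminf` (`m ≤ liminf_L D` for EVERY `h > 0`), whence
  `m - ε' < D` eventually in `L`, and with `0 ≤ D ≤ B_d`, `0 ≤ m` this gives `D² ≥ m² - ε/2` for a suitable
  `ε' = ε / (4 (B_d + ε + 1))`.

The case `t = 0` is `0 ≤ 0`. No definition is introduced; the helper lemmas are private. [folklore]
-/

noncomputable section

set_option linter.dupNamespace false

namespace Summit.HubbardSuperconductivity.HubbardSuperconductivity.Theorems.CwSsbToEvenTorusLRO

open Literature.MathematicalPhysics.QuantumLattice Matrix Filter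
open scoped Matrix ComplexOrder
open _root_.Topology

/-- Real bookkeeping, the square floor: from `0 ≤ m`, `0 ≤ D ≤ C`, `m - ε' < D` and
`ε' = ε / (4 (C + ε + 1))` one gets `m² - ε/2 ≤ D²`. [folklore] -/
private theorem acf_sq_floor {m D C ε ε' : ℝ} (hm : 0 ≤ m) (hD : 0 ≤ D) (hDC : D ≤ C) (hε : 0 < ε)
    (hε' : 0 < ε') (hε'ε : ε' ≤ ε) (hkey : ε' * (4 * (C + ε + 1)) = ε) (hlt : m - ε' < D) :
    m ^ 2 - ε / 2 ≤ D ^ 2 := by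
  have h1 : m ^ 2 ≤ (D + ε') ^ 2 := by
    nlinarith [mul_nonneg (sub_nonneg.2 hlt.le) (add_nonneg (add_nonneg hD hε'.le) hm)]
  have h2 : D * ε' ≤ C * ε' := mul_le_mul_of_nonneg_right hDC hε'.le
  have h3 : ε' * ε' ≤ ε' * ε := mul_le_mul_of_nonneg_left hε'ε hε'.le
  have h4 : 0 ≤ ε' * ε := mul_nonneg hε'.le hε.le
  nlinarith [h1, h2, h3, h4, hkey]

/-- Real bookkeeping, the chord combination: the sourced attractive chord (`a - b ≤ -t x²/A`, `x = D A`),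
the two source removals (`|a - c|, |b - d| ≤ 12 h A`, `48 h = t ε`) and the square floor `m² - ε/2 ≤ D²`
give `t (m² - ε) A ≤ d - c`. [folklore] -/
private theorem acf_combine {a b c d x D A t h m ε : ℝ} (hA : 0 < A) (ht : 0 ≤ t)
    (hx : x = D * A) (hS1 : a - b ≤ -t * x ^ 2 / A) (hS4a : |a - c| ≤ 12 * |h| * A)
    (hS4b : |b - d| ≤ 12 * |h| * A) (hh : 0 < h) (hht : 48 * h = t * ε)
    (hfloor : m ^ 2 - ε / 2 ≤ D ^ 2) : t * (m ^ 2 - ε) * A ≤ d - c := by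
  rw [abs_of_pos hh] at hS4a hS4b
  obtain ⟨h1, -⟩ := abs_le.mp hS4a
  obtain ⟨-, h4⟩ := abs_le.mp hS4b
  have hA' : A ≠ 0 := hA.ne'
  have e : -t * x ^ 2 / A = -(t * A * D ^ 2) := by
    rw [hx]
    field_simp
  rw [e] at hS1
  have k1 : t * A * (m ^ 2 - ε / 2) ≤ t * A * D ^ 2 :=
    mul_le_mul_of_nonneg_left hfloor (mul_nonneg ht hA.le)
  have k2 : 48 * h * A = t * ε * A := by rw [hht]
  nlinarith [h1, h4, hS1, k1, k2]

/-- The staircase lever, eventual form: for every `h > 0` and `ε' > 0`, eventually in `L` the sourced pair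
density exceeds `m - ε'` (`m ≤ liminf_L D_{L+1}(h)` and `D ≥ 0`). [folklore] -/
private theorem acf_eventually_density_gt (U μ : ℝ) {h ε' : ℝ} (hh : 0 < h) (hε' : 0 < ε') :
    ∀ᶠ L : ℕ in atTop, dWaveOrderParameter U μ - ε' < dWaveSourceDensity (L + 1) U μ h := by
  have hlim := dWaveOrderParameter_le_liminf U μ hh
  refine eventually_lt_of_lt_liminf (lt_of_lt_of_le (sub_lt_self _ hε') hlim) ?_
  exact isBoundedUnder_of_eventually_ge
    (Eventually.of_forall fun L => dWaveSourceDensity_nonneg U μ hh.le)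

/-- **Stub S6 — attractive chord floor.** For all `U, μ`, every block scale `R ≥ 1`, every attractive
coupling `t ≥ 0` and every `ε > 0`, eventually in the side `L+1`:
`E₀(K_μ) − E₀(K_μ − t W_R) ≥ t (m² − ε) (L+1)²`, `m = dWaveOrderParameter U μ` — Koma–Tasaki order forces
the ATTRACTIVE block slope of the source-free grand-canonical energy to be at least `m²`. Proof: S1 at
`κ = 0` (sourced attractive chord `≥ t (Re ω_h(P))²/L²`), S4 twice (remove the source at couplings `−t` and
`0`, cost `24hL²`), the staircase lever `dWaveOrderParameter_le_liminf` (`m ≤ liminf_L D_{L+1}(h)` for EVERY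
`h > 0`), and `h := tε/48`. [cite: KomaTasaki1994, §1] -/
theorem stub_attractiveChordFloor :
    ∀ (U μ : ℝ) (R : ℕ), 0 < R → ∀ (t ε : ℝ), 0 ≤ t → 0 < ε → ∀ᶠ L : ℕ in Filter.atTop, t * (dWaveOrderParameter U μ ^ 2 - ε) * ((L + 1 : ℕ) : ℝ) ^ 2 ≤ (hubbardTorusWith 2 (L + 1) 1 U μ).groundEnergy - (hubbardTorusWith 2 (L + 1) 1 U μ + ((-t : ℝ) : ℂ) • (((((R : ℝ) ^ 4)⁻¹ : ℝ) : ℂ) • ∑ a : Literature.Probability.LatticeModels.TorusSite 2 (L + 1), (∑ u : Fin 2 → Fin R, localPair dWaveFormFactor (L + 1) (a + fun i => ((u i : ℕ) : ZMod (L + 1))))ᴴ * (∑ u : Fin 2 → Fin R, localPair dWaveFormFactor (L + 1) (a + fun i => ((u i : ℕ) : ZMod (L + 1)))))).groundEnergy := by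
  intro U μ R hR t ε ht hε
  rcases ht.eq_or_lt with rfl | ht'
  · refine Eventually.of_forall fun L => ?_
    simp
  · have hm0 : 0 ≤ dWaveOrderParameter U μ := dWaveOrderParameter_nonneg U μ
    have hmC := dWaveOrderParameter_le_const U μ
    set C : ℝ := 2 * ∑ e ∈ insert (0 : Literature.Probability.LatticeModels.Site 2) unitSteps,
      |dWaveFormFactor e / Real.sqrt 2| with hC
    have hC0 : 0 ≤ C := hm0.trans hmC
    have hh : 0 < t * ε / 48 := by positivity
    have hN : 0 < 4 * (C + ε + 1) := by positivity
    have hε' : 0 < ε / (4 * (C + ε + 1)) := div_pos hε hN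
    have hkey : ε / (4 * (C + ε + 1)) * (4 * (C + ε + 1)) = ε := div_mul_cancel₀ ε hN.ne'
    have hε'ε : ε / (4 * (C + ε + 1)) ≤ ε := by
      rw [div_le_iff₀ hN]
      nlinarith [mul_nonneg hε.le hC0, sq_nonneg ε]
    filter_upwards [acf_eventually_density_gt U μ hh hε'] with L hL
    have hS1 := stub_blockSlope (L + 1) R hR U μ (t * ε / 48) 0 t ht
    have hS4a := stub_sourceRemoval (L + 1) R U μ (t * ε / 48) (-t)
    have hS4b := stub_sourceRemoval (L + 1) R U μ (t * ε / 48) 0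
    simp only [zero_sub, Complex.ofReal_zero, zero_smul, add_zero] at hS1 hS4b
    have hA : (0 : ℝ) < ((L + 1 : ℕ) : ℝ) ^ 2 := cast_sq_pos_of_neZero (L + 1)
    have hD0 : 0 ≤ dWaveSourceDensity (L + 1) U μ (t * ε / 48) := dWaveSourceDensity_nonneg U μ hh.le
    have hDC : dWaveSourceDensity (L + 1) U μ (t * ε / 48) ≤ C :=
      dWaveSourceDensity_le_const (L + 1) U μ _
    have hx : ((dWaveSourceTorus (L + 1) U μ (t * ε / 48)).groundStateFunctional
        (pairField dWaveFormFactor (L + 1))).re =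
          dWaveSourceDensity (L + 1) U μ (t * ε / 48) * ((L + 1 : ℕ) : ℝ) ^ 2 := by
      rw [dWaveSourceDensity, div_mul_cancel₀ _ hA.ne']
    have hfloor := acf_sq_floor hm0 hD0 hDC hε hε' hε'ε hkey hL
    exact acf_combine hA ht hx hS1 hS4a hS4b hh (by ring) hfloor

end Summit.HubbardSuperconductivity.HubbardSuperconductivity.Theorems.CwSsbToEvenTorusLRO

end
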